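import Summits.AtomisticToContinuum.Crystallization.Theorems.FrustratedLawDichotomyPeriodicBlockViolation
import Summits.AtomisticToContinuum.Crystallization.Theorems.FrustratedLawDichotomyBumpRadialCertLJ
import Summits.AtomisticToContinuum.Crystallization.Theorems.FrustratedLawDichotomyAveragingCutC
import Literature.Geometry.DiscreteGeometry.KissingRigidity

/-!
# FrustratedLawDichotomy · crux `AperiodicFrustratedLawGap` (stmt-AtomisticToContinuum-27623) — CELL CERTIFICATE KIT, part W:
# rational points and a certified rational upper bound of the range-9/2 effective potential `W₄₅`
# (decomp-a2c, prover hand 1, generation 15; critic row 564 (i): instantiate the periodic-block negative kernel at exact-rational witness cells)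

The periodic-block negative kernel `…PeriodicBlockViolation.not_schurElasticPricing_of_cell` needs, for a concrete cell, the deficit
`Σ_m [(Σ_q W(|x_m − superMotif q|) − W 0)/2 − A] ≤ N₀·(L₀ − δ)`.  This part supplies the two kernel-evaluable ingredients:

* §1 RATIONAL POINTS `qpt c P = c⁻¹ • intVec P` (`P ∈ ℤ³`, common denominator `c ∈ ℕ`): `dist (qpt c P) (qpt c Q) = c⁻¹·√(sqNormInt (P − Q))`,
  lattice vectors of an integer cell stay in the same form (`latVec_qpt`);
* §2 ★ `effPot_le_ubW` — for `r ≥ 0` with `r² = Q` and a rational enclosure `lo ≤ r ≤ hi` (`lo² ≤ Q ≤ hi²`), the RATIONAL number `ubW Q lo hi`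
  bounds `W₄₅(r) = V(r)(1 − w₄₅ r) − (3/200)·ω₂(5r/4)` from above: `V` is exact in `Q = r²`; on the window `(3, 9/2)` one has
  `1 − w₄₅ r = (−27 − 20Q/3) + r·(24 + 16Q/27)` with `V < 0`, so `r ↦ lo` bounds it; `ω₂(x) = E(x²) + x·O(x²)` (even/odd split of the
  degree-11 profile), so `x·O ≥ min (x_lo·O) (x_hi·O)`.  No monotonicity facts are used; `W₄₅(0) = −3/200` (`effPot_fourHalf_zero`) and the
  crude global bound `W₄₅ ≤ 7` on `[7/10, ∞)` (`effPot_fourHalf_le_seven`, the kernel's `Wsup`).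

All `[folklore]`; 0 sorry.
-/

noncomputable section

namespace Summit.AtomisticToContinuum.Crystallization.Theorems.FrustratedLawDichotomyCellKitW

open scoped BigOperators
open Literature.Geometry.DiscreteGeometry (intVec sqNormInt norm_intVec intVec_sub intVec_apply intVec_add intVec_zsmul)
open Literature.MathematicalPhysics.StatisticalMechanics (lennardJones)
open Summit.AtomisticToContinuum.Crystallization.Theorems.ChargedEnergyGapNegative (E3)
open Summit.AtomisticToContinuum.Crystallization.Theorems.FrustratedLawDichotomySchurCut
open Summit.AtomisticToContinuum.Crystallization.Theorems.FrustratedLawDichotomyPeriodicBlockGeometry (latVec)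

/-! ## §1. Rational points with a common denominator -/

/-- **`qpt c P = c⁻¹ • intVec P`** — the point of `ℝ³` with rational coordinates `P / c`. -/
def qpt (c : ℕ) (P : Fin 3 → ℤ) : E3 := ((c : ℝ))⁻¹ • intVec P

/-- Differences of rational points. [folklore] -/
theorem qpt_sub (c : ℕ) (P Q : Fin 3 → ℤ) : qpt c P - qpt c Q = qpt c (P - Q) := by
  simp only [qpt, ← smul_sub, intVec_sub]

/-- Sums of rational points. [folklore] -/
theorem qpt_add (c : ℕ) (P Q : Fin 3 → ℤ) : qpt c P + qpt c Q = qpt c (P + Q) := by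
  simp only [qpt, ← smul_add, intVec_add]

/-- **Distances between rational points**: `dist (P/c) (Q/c) = c⁻¹·√|P − Q|²`. [folklore] -/
theorem dist_qpt {c : ℕ} (hc : 0 < c) (P Q : Fin 3 → ℤ) :
    dist (qpt c P) (qpt c Q) = ((c : ℝ))⁻¹ * Real.sqrt (sqNormInt (P - Q) : ℝ) := by
  have hc' : (0 : ℝ) < c := by exact_mod_cast hc
  rw [dist_eq_norm, qpt_sub, qpt, norm_smul, norm_inv, Real.norm_of_nonneg hc'.le, norm_intVec]

/-- Squared distances between rational points are rational: `dist² = |P − Q|²/c²`. [folklore] -/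
theorem dist_qpt_sq {c : ℕ} (hc : 0 < c) (P Q : Fin 3 → ℤ) :
    dist (qpt c P) (qpt c Q) ^ 2 = (sqNormInt (P - Q) : ℝ) / (c : ℝ) ^ 2 := by
  have hc' : (0 : ℝ) < c := by exact_mod_cast hc
  have hnn : (0 : ℝ) ≤ (sqNormInt (P - Q) : ℝ) := by
    have : (0 : ℤ) ≤ sqNormInt (P - Q) := by unfold sqNormInt; positivity
    exact_mod_cast this
  rw [dist_qpt hc, mul_pow, Real.sq_sqrt hnn, inv_pow]
  field_simp

/-- **Integer lattice vectors of an integer cell**: `latZ A s = Σ_k s_k • A_k`. -/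
def latZ (A : Fin 3 → Fin 3 → ℤ) (s : Fin 3 → ℤ) : Fin 3 → ℤ := ∑ k, s k • A k

/-- Lattice vectors of the cell `k ↦ A_k / c` are the rational points `(Σ_k s_k A_k)/c`. [folklore] -/
theorem latVec_qpt (c : ℕ) (A : Fin 3 → Fin 3 → ℤ) (s : Fin 3 → ℤ) :
    latVec (fun k => qpt c (A k)) s = qpt c (latZ A s) := by
  simp only [latVec, latZ, qpt]
  rw [show intVec (∑ k, s k • A k) = ∑ k, (s k : ℝ) • intVec (A k) by
    rw [show (∑ k, s k • A k) = ∑ k ∈ Finset.univ, s k • A k from rfl]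
    induction (Finset.univ : Finset (Fin 3)) using Finset.induction_on with
    | empty => simp; ext i; simp [intVec]
    | insert a s' ha ih => rw [Finset.sum_insert ha, Finset.sum_insert ha, intVec_add, intVec_zsmul, ih]]
  rw [Finset.smul_sum]
  refine Finset.sum_congr rfl fun k _ => ?_
  rw [smul_comm]

/-! ## §2. The certified rational upper bound of `W₄₅` -/

/-- `V` as an exact rational function of `Q = r²`: `Q⁻⁶/12 − Q⁻³/6`. -/
def Vq (Q : ℚ) : ℚ := 1 / 12 * (Q⁻¹) ^ 6 - 1 / 6 * (Q⁻¹) ^ 3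

/-- Even part `E(z)` of the bump profile `ω₂(x) = E(x²) + x·O(x²)`. -/
def Ez (z : ℚ) : ℚ := 1 - 11 / 6 * z + 33 / 16 * z ^ 2

/-- Odd part `O(z)` of the bump profile. -/
def Oz (z : ℚ) : ℚ := -(77 / 64) * z ^ 2 + 33 / 256 * z ^ 3 - 11 / 1024 * z ^ 4 + 5 / 12288 * z ^ 5

/-- ★ **`ubW Q lo hi`** — rational upper bound of `W₄₅(r)` for `r² = Q`, `lo ≤ r ≤ hi`. -/
def ubW (Q lo hi : ℚ) : ℚ :=
  if 81 / 4 ≤ Q then 0 else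
    ((if Q ≤ 9 then Vq Q else Vq Q * (-27 - 20 / 3 * Q) + lo * (Vq Q * (24 + 16 / 27 * Q))) +
      (if Q < 64 / 25 then -(3 / 200) * (Ez (25 / 16 * Q) + min (5 / 4 * lo * Oz (25 / 16 * Q)) (5 / 4 * hi * Oz (25 / 16 * Q)))
       else 0))

/-- `V(r) = Vq(r²)`. [folklore] -/
theorem lennardJones_eq_Vq {r : ℝ} {Q : ℚ} (hrQ : r ^ 2 = Q) : lennardJones r = (Vq Q : ℝ) := by
  have h12 : (r⁻¹) ^ 12 = ((r ^ 2)⁻¹) ^ 6 := by rw [inv_pow, inv_pow, ← pow_mul]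
  have h6 : (r⁻¹) ^ 6 = ((r ^ 2)⁻¹) ^ 3 := by rw [inv_pow, inv_pow, ← pow_mul]
  simp only [lennardJones, Vq, h12, h6, hrQ]
  push_cast
  ring

/-- On the window `[3, 9/2]`: `1 − w₄₅ r = (−27 − 20r²/3) + r·(24 + 16r²/27)`. [folklore] -/
theorem one_sub_w₄₅_eq {r : ℝ} (h1 : 3 ≤ r) (h2 : r ≤ 9 / 2) :
    1 - w₄₅ r = (-27 - 20 / 3 * r ^ 2) + r * (24 + 16 / 27 * r ^ 2) := by
  unfold w₄₅ cutWeight smoothstep₁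
  rw [show (9 / 2 : ℝ) - 3 = 3 / 2 by norm_num]
  have hx0 : 0 ≤ (r - 3) / (3 / 2) := by positivity
  have hx1 : (r - 3) / (3 / 2) ≤ 1 := by rw [div_le_one (by norm_num)]; linarith
  split_ifs with ha hb
  · have hr : r = 3 := by
      have : (r - 3) / (3 / 2) = 0 := le_antisymm ha hx0
      field_simp at this; linarith
    subst hr; norm_num
  · have hr : r = 9 / 2 := by
      have : (r - 3) / (3 / 2) = 1 := le_antisymm hx1 hb
      field_simp at this; linarith
    subst hr; norm_num
  · field_simp
    ring

/-- Inside its support the bump profile splits into even and odd parts: `ω₂(x) = E(x²) + x·O(x²)`. [folklore] -/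
theorem omega₂_eq_EO {x : ℝ} (hx : x < 2) {z : ℚ} (hz : x ^ 2 = z) :
    omega₂ x = (Ez z : ℝ) + x * (Oz z : ℝ) := by
  rw [omega₂, if_pos hx]
  simp only [Ez, Oz]
  push_cast
  rw [← hz]
  ring

/-- `V < 0` once `r² > 9` (indeed once `r⁶ > 2`). [folklore] -/
theorem Vq_neg {Q : ℚ} (hQ : 9 < Q) : Vq Q < 0 := by
  have hQ0 : 0 < Q := by linarith
  have hi : Q⁻¹ < 1 / 9 := by rw [inv_lt_comm₀ hQ0 (by norm_num)]; norm_num; exact hQ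
  have hi0 : 0 < Q⁻¹ := inv_pos.mpr hQ0
  unfold Vq
  have h3 : (Q⁻¹) ^ 3 < (1 / 9) ^ 3 := pow_lt_pow_left₀ hi hi0.le (by norm_num)
  have h6 : (Q⁻¹) ^ 6 = ((Q⁻¹) ^ 3) ^ 2 := by ring
  rw [h6]
  nlinarith [pow_pos hi0 3]

/-- `a² ≤ r²` with `a, r ≥ 0` gives `a ≤ r` (rational `a`, real `r` with `r² = Q`). [folklore] -/
theorem cast_le_of_sq_le {a Q : ℚ} {r : ℝ} (hr : 0 ≤ r) (hrQ : r ^ 2 = Q) (ha : 0 ≤ a) (h : a ^ 2 ≤ Q) : (a : ℝ) ≤ r := by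
  have h' : ((a : ℝ)) ^ 2 ≤ r ^ 2 := by rw [hrQ]; exact_mod_cast h
  exact (pow_le_pow_iff_left₀ (by exact_mod_cast ha) hr two_ne_zero).1 h'

/-- `r² ≤ a²` with `a, r ≥ 0` gives `r ≤ a`. [folklore] -/
theorem le_cast_of_le_sq {a Q : ℚ} {r : ℝ} (hr : 0 ≤ r) (hrQ : r ^ 2 = Q) (ha : 0 ≤ a) (h : Q ≤ a ^ 2) : r ≤ (a : ℝ) := by
  have h' : r ^ 2 ≤ ((a : ℝ)) ^ 2 := by rw [hrQ]; exact_mod_cast h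
  exact (pow_le_pow_iff_left₀ hr (by exact_mod_cast ha) two_ne_zero).1 h'

/-- `r² < a²` with `a, r ≥ 0` gives `r < a`. [folklore] -/
theorem lt_cast_of_lt_sq {a Q : ℚ} {r : ℝ} (hr : 0 ≤ r) (hrQ : r ^ 2 = Q) (ha : 0 ≤ a) (h : Q < a ^ 2) : r < (a : ℝ) := by
  have h' : r ^ 2 < ((a : ℝ)) ^ 2 := by rw [hrQ]; exact_mod_cast h
  exact (pow_lt_pow_iff_left₀ hr (by exact_mod_cast ha) two_ne_zero).1 h'

/-- ★ **THE CERTIFIED UPPER BOUND**: `W₄₅(r) ≤ ubW Q lo hi` for `0 ≤ r`, `r² = Q > 0`, `0 ≤ lo`, `lo² ≤ Q ≤ hi²`. [folklore] -/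
theorem effPot_le_ubW {Q lo hi : ℚ} {r : ℝ} (hr : 0 ≤ r) (hrQ : r ^ 2 = Q) (hQ : 0 < Q) (hlo : 0 ≤ lo) (hhi : 0 ≤ hi)
    (hlo2 : lo ^ 2 ≤ Q) (hhi2 : Q ≤ hi ^ 2) : effPot w₄₅ ω₄ (3 / 400) r ≤ (ubW Q lo hi : ℝ) := by
  have hlor : (lo : ℝ) ≤ r := cast_le_of_sq_le hr hrQ hlo hlo2
  have hrhi : r ≤ (hi : ℝ) := le_cast_of_le_sq hr hrQ hhi hhi2
  have hQr : (0 : ℝ) < (Q : ℝ) := by exact_mod_cast hQ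
  unfold ubW
  split_ifs with h81 h9 h64 h64'
  · -- `r ≥ 9/2`: the potential vanishes
    have hr92 : (((9 / 2 : ℚ)) : ℝ) ≤ r := cast_le_of_sq_le hr hrQ (by norm_num) (by norm_num; linarith)
    rw [effPot_fourHalf_eq_zero _ (by push_cast at hr92; linarith)]; simp
  all_goals
    have hV := lennardJones_eq_Vq hrQ
    simp only [effPot, corePot, ω₄]
  · -- `Q ≤ 9`, `Q < 64/25`
    have hr3 : r ≤ ((3 : ℚ) : ℝ) := le_cast_of_le_sq hr hrQ (by norm_num) (by norm_num; linarith)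
    have hr85 : r < ((8 / 5 : ℚ) : ℝ) := lt_cast_of_lt_sq hr hrQ (by norm_num) (by norm_num; linarith)
    have hx2 : 5 * r / 4 < 2 := by push_cast at hr85; linarith
    have hz : (5 * r / 4) ^ 2 = ((25 / 16 * Q : ℚ) : ℝ) := by push_cast; rw [← hrQ]; ring
    rw [FrustratedLawDichotomyBumpAutocorrelation.w₄₅_eq_zero (by push_cast at hr3; linarith), hV, omega₂_eq_EO hx2 hz]
    push_cast
    have hmin : min (5 / 4 * (lo : ℝ) * (Oz (25 / 16 * Q) : ℝ)) (5 / 4 * (hi : ℝ) * (Oz (25 / 16 * Q) : ℝ)) ≤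
        5 * r / 4 * (Oz (25 / 16 * Q) : ℝ) := by
      rcases le_or_gt 0 (Oz (25 / 16 * Q) : ℝ) with hO | hO
      · exact (min_le_left _ _).trans (by nlinarith)
      · exact (min_le_right _ _).trans (by nlinarith)
    linarith
  · -- `Q ≤ 9`, `64/25 ≤ Q`
    have hr3 : r ≤ ((3 : ℚ) : ℝ) := le_cast_of_le_sq hr hrQ (by norm_num) (by norm_num; linarith)
    have hr85 : (((8 / 5 : ℚ)) : ℝ) ≤ r := cast_le_of_sq_le hr hrQ (by norm_num) (by norm_num; linarith)
    have hx2 : 2 ≤ 5 * r / 4 := by push_cast at hr85; linarith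
    rw [FrustratedLawDichotomyBumpAutocorrelation.w₄₅_eq_zero (by push_cast at hr3; linarith), hV, omega₂_of_two_le hx2]
    push_cast
    linarith
  · -- `9 < Q < 64/25`: impossible
    exfalso; push Not at h9; linarith
  · -- the window `9 < Q < 81/4`
    push Not at h81 h9
    have hr3' : (((3 : ℚ)) : ℝ) ≤ r := cast_le_of_sq_le hr hrQ (by norm_num) (by norm_num; linarith)
    have hr92' : r ≤ ((9 / 2 : ℚ) : ℝ) := le_cast_of_le_sq hr hrQ (by norm_num) (by norm_num; linarith)
    have hr3 : 3 ≤ r := by push_cast at hr3'; linarith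
    have hr92 : r ≤ 9 / 2 := by push_cast at hr92'; linarith
    have hx2 : 2 ≤ 5 * r / 4 := by linarith
    have hw : lennardJones r * (1 - w₄₅ r) =
        (Vq Q : ℝ) * (-27 - 20 / 3 * (Q : ℝ)) + r * ((Vq Q : ℝ) * (24 + 16 / 27 * (Q : ℝ))) := by
      rw [one_sub_w₄₅_eq hr3 hr92, hV, hrQ]; ring
    have hVneg : (Vq Q : ℝ) < 0 := by exact_mod_cast Vq_neg h9
    have hβ : 0 < (24 + 16 / 27 * (Q : ℝ)) := by linarith
    have hVβ : (Vq Q : ℝ) * (24 + 16 / 27 * (Q : ℝ)) ≤ 0 := (mul_neg_of_neg_of_pos hVneg hβ).le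
    have hmono : r * ((Vq Q : ℝ) * (24 + 16 / 27 * (Q : ℝ))) ≤ (lo : ℝ) * ((Vq Q : ℝ) * (24 + 16 / 27 * (Q : ℝ))) :=
      mul_le_mul_of_nonpos_right hlor hVβ
    rw [hw, omega₂_of_two_le hx2]
    push_cast
    linarith

/-- `W₄₅(0) = −3/200` (the self term of a site sum; `V(0) = 0` by `0⁻¹ = 0`). [folklore] -/
theorem effPot_fourHalf_zero : effPot w₄₅ ω₄ (3 / 400) 0 = -(3 / 200) := by
  have hw : w₄₅ 0 = 0 := FrustratedLawDichotomyBumpAutocorrelation.w₄₅_eq_zero (by norm_num)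
  simp [effPot, corePot, ω₄, hw, lennardJones, omega₂_zero]
  norm_num

/-- **Crude global bound `W₄₅ ≤ 7` on `[7/10, ∞)`** (the kernel's `Wsup`; only its existence matters): `V ≤ r⁻¹²/12 ≤ (10/7)¹²/12 < 6.1`,
`0 ≤ 1 − w₄₅ ≤ 1`, `ω₂ ≥ 0`. [folklore] -/
theorem effPot_fourHalf_le {r : ℝ} (hr : 7 / 10 ≤ r) : effPot w₄₅ ω₄ (3 / 400) r ≤ 7 := by
  have hr0 : 0 < r := by linarith
  have hw := FrustratedLawDichotomyAveragingCut.w₄₅_mem r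
  have hV : lennardJones r ≤ 61 / 10 := by
    have hinv : r⁻¹ ≤ 10 / 7 := by rw [inv_le_comm₀ hr0 (by norm_num)]; norm_num; linarith
    have h1 : (r⁻¹) ^ 12 ≤ ((10 : ℝ) / 7) ^ 12 := pow_le_pow_left₀ (by positivity) hinv 12
    have h2 : (0 : ℝ) ≤ (r⁻¹) ^ 6 := by positivity
    unfold lennardJones
    nlinarith
  have hω : 0 ≤ ω₄ r := FrustratedLawDichotomyBumpAutocorrelation.omega₂_nonneg (by positivity)
  unfold effPot corePot
  rcases le_or_gt 0 (lennardJones r) with hV0 | hV0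
  · nlinarith [hw.1, hw.2]
  · nlinarith [hw.1, hw.2]

end Summit.AtomisticToContinuum.Crystallization.Theorems.FrustratedLawDichotomyCellKitW

end
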